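import Literature.AnabelianGeometry.EtaleTheta.FrobenioidCyclotomicRigidity
import HarnessLib

/-!
# [EtTh] §5 p.327: the subquotient record `ThetaSubquotientProj 𝔉` — inhabitation criterion (NV-L2 census v2, last substantive open row)

S. Mochizuki, *The étale theta function and its Frobenioid-theoretic manifestations*, Publ. RIMS **45**
(2009), §5 p.327 (PDF p.101) [cite: MochizukiEtTh2009, §5 p.327 (PDF p.101)]: "these subquotients
determine subquotients `Aut_D(D) ↠ Aut^Θ_D(D)`; `(l·Δ_Θ)_D ⊆ Aut^Θ_D(D)`".  abc-iut-L2-t4 records this as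
`FrobenioidCyclotomicRigidity.ThetaSubquotientProj 𝔉` (`FrobenioidCyclotomicRigidity.lean`): for EVERY
object `E` of the base `D` a subgroup `pre E ≤ Aut E` and a SURJECTION `proj E : pre E →* 𝔉.lDelta E`.
It is consumed as a binder `(P : ThetaSubquotientProj 𝔉)` by the whole Prop. 5.5 / Thm. 5.6 chain
(`Thm56SubdagProofs`, `Discharge/Sec5*OfBiKummerData*`), so its inhabitation decides whether those
theorems quantify over anything.

NV-L2 census v2b (abc-iut-w5-d029, L2-lead #5-R45): ZERO producers.  This PROOF-ONLY file (0 definitions; no field added, no instance attribute, no Prop fact) makes the row's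
status exact:

* `ThetaSubquotientProj.nonempty_of_surjective` — if every `(l·Δ_Θ)_E` is presented as a QUOTIENT of `Aut E` itself
  (`f E : Aut E →* 𝔉.lDelta E` onto), the record is inhabited (`pre := ⊤`);
* `ThetaSubquotientProj.nonempty_of_subsingleton` — if every `(l·Δ_Θ)_E` is trivial, it is inhabited (`pre := ⊥`);
* `ThetaSubquotientProj.subsingleton_lDelta_of_subsingleton_aut` — NECESSARY CONDITION: under any
  `P : ThetaSubquotientProj 𝔉`, a RIGID object (`Aut E` trivial) has trivial `(l·Δ_Θ)_E`; more generally
  `(l·Δ_Θ)_E` is a homomorphic image of a subgroup of `Aut E` (`exists_surjective_of_subgroup_aut`), so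
  `Nat.card (𝔉.lDelta E) ∣ Nat.card (P.pre E)` (`card_lDelta_dvd`);
* hence `isEmpty_of_rigid_of_nontrivial` — ONE rigid object with non-trivial `(l·Δ_Θ)_E` empties the
  record, and every `(P : ThetaSubquotientProj 𝔉)`-quantified theorem over such `𝔉` is vacuous.

READING for the owners (abc-iut-L2-t4 §5 / abc-iut-L2-t9 `thetaSubquotientStub`, MERGE-PLAN row 2): the
genuine carrier of `ThetaSubquotientOfTempered.lean` is print's subquotient of `Aut_D(E)` AT GALOIS
OBJECTS and a coinvariant ENLARGEMENT at non-Galois connected objects (that file's header); whether some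
non-Galois connected `E = Π/H` with `N_Π(H) = H` has non-trivial carrier decides, by
`isEmpty_of_rigid_of_nontrivial`, whether the record as typed (∀ E) can be inhabited at the genuine data
or must be restricted to Galois / `N`-codomain objects (a v-next statement change).  Nothing here asserts
either alternative.  [EtTh] is refereed; typed ≠ proved; no side taken on [IUTchIII] Cor. 3.12.
-/

namespace Literature.AnabelianGeometry.EtaleTheta

namespace FrobenioidCyclotomicRigidity

open CategoryTheory

universe w v v' u u'

variable {C : Type u} [Category.{v} C] {D : Type u'} [Category.{v'} D] {𝔉 : ThetaFrobenioid.{w} C D}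

namespace ThetaSubquotientProj

/-- **Producer 1**: if `(l·Δ_Θ)_E` is presented as a quotient of the whole `Aut_D(E)` at every
object, the record is inhabited (`pre := ⊤`). [cite: MochizukiEtTh2009, §5 p.327 (PDF p.101)] -/
theorem nonempty_of_surjective (f : ∀ E : D, Aut E →* 𝔉.lDelta E)
    (hf : ∀ E, Function.Surjective (f E)) : Nonempty (ThetaSubquotientProj 𝔉) :=
  ⟨{ pre := fun _ => ⊤
     proj := fun E => (f E).comp (Subgroup.subtype ⊤)
     proj_surjective := fun E y => by
       obtain ⟨x, rfl⟩ := hf E y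
       exact ⟨⟨x, Subgroup.mem_top x⟩, rfl⟩ }⟩

/-- **Producer 2**: if every `(l·Δ_Θ)_E` is trivial the record is inhabited (`pre := ⊥`, `proj := 1`).
[cite: MochizukiEtTh2009, §5 p.327 (PDF p.101)] -/
theorem nonempty_of_subsingleton (h : ∀ E : D, Subsingleton (𝔉.lDelta E)) :
    Nonempty (ThetaSubquotientProj 𝔉) :=
  ⟨{ pre := fun _ => ⊥
     proj := fun _ => 1
     proj_surjective := fun E y => ⟨1, (h E).elim _ y⟩ }⟩

/-- Under any `P`, `(l·Δ_Θ)_E` is a homomorphic image of a subgroup of `Aut_D(E)` (restatement of the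
record's content as an `∃`). [cite: MochizukiEtTh2009, §5 p.327 (PDF p.101)] -/
theorem exists_surjective_of_subgroup_aut (P : ThetaSubquotientProj 𝔉) (E : D) :
    ∃ (S : Subgroup (Aut E)) (f : S →* 𝔉.lDelta E), Function.Surjective f :=
  ⟨P.pre E, P.proj E, P.proj_surjective E⟩

/-- **Necessary condition — rigid objects have trivial theta subquotient**: if `Aut_D(E)` is trivial,
so is `(l·Δ_Θ)_E` under any `P : ThetaSubquotientProj 𝔉`. [cite: MochizukiEtTh2009, §5 p.327 (PDF p.101)] -/
theorem subsingleton_lDelta_of_subsingleton_aut (P : ThetaSubquotientProj 𝔉) (E : D)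
    [Subsingleton (Aut E)] : Subsingleton (𝔉.lDelta E) := by
  constructor
  intro a b
  obtain ⟨x, rfl⟩ := P.proj_surjective E a
  obtain ⟨y, rfl⟩ := P.proj_surjective E b
  have hxy : x = y := Subtype.ext (Subsingleton.elim _ _)
  rw [hxy]

/-- Cardinality form: `|(l·Δ_Θ)_E|` divides `|pre E|` (`Nat.card`, `0` for infinite), hence divides
`|Aut_D(E)|` by Lagrange. [cite: MochizukiEtTh2009, §5 p.327 (PDF p.101)] -/
theorem card_lDelta_dvd (P : ThetaSubquotientProj 𝔉) (E : D) :
    Nat.card (𝔉.lDelta E) ∣ Nat.card (P.pre E) :=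
  Subgroup.card_dvd_of_surjective (P.proj E) (P.proj_surjective E)

/-- **Emptiness certificate shape**: ONE object with trivial `Aut_D(E)` and non-trivial `(l·Δ_Θ)_E`
makes `ThetaSubquotientProj 𝔉` EMPTY (so every theorem binding `P : ThetaSubquotientProj 𝔉` over such
`𝔉` is vacuous). [cite: MochizukiEtTh2009, §5 p.327 (PDF p.101)] -/
theorem isEmpty_of_rigid_of_nontrivial (E : D) [Subsingleton (Aut E)] [Nontrivial (𝔉.lDelta E)] :
    IsEmpty (ThetaSubquotientProj 𝔉) :=
  ⟨fun P => by
    haveI := subsingleton_lDelta_of_subsingleton_aut P E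
    exact false_of_nontrivial_of_subsingleton (𝔉.lDelta E)⟩

/-- **Inhabitation criterion**: `ThetaSubquotientProj 𝔉` is inhabited iff every `(l·Δ_Θ)_E` is a
homomorphic image of a subgroup of `Aut_D(E)`. [cite: MochizukiEtTh2009, §5 p.327 (PDF p.101)] -/
theorem nonempty_iff :
    Nonempty (ThetaSubquotientProj 𝔉) ↔
      ∀ E : D, ∃ (S : Subgroup (Aut E)) (f : S →* 𝔉.lDelta E), Function.Surjective f := by
  constructor
  · rintro ⟨P⟩ E
    exact exists_surjective_of_subgroup_aut P E
  · intro h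
    choose S f hf using h
    exact ⟨⟨S, f, hf⟩⟩

end ThetaSubquotientProj

end FrobenioidCyclotomicRigidity

end Literature.AnabelianGeometry.EtaleTheta
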